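import Summits.HubbardSuperconductivity.HubbardSuperconductivity.Theorems.WidthHaldaneDefs
import Literature.MathematicalPhysics.QuantumLattice.SiteBijectionSectorTransport
import Literature.MathematicalPhysics.QuantumLattice.HubbardTorusFlux
import Literature.MathematicalPhysics.QuantumLattice.HubbardRingPerronFrobeniusProofs

/-!
# Kinematics of the Hubbard tubes `ℤ/L × ℤ/M`: hermiticity, sectors, time reversal, relabelling,
# existence of sector ground states

Support file for the cruxes stated over `WidthHaldaneDefs` (routes `WidthHaldane`, `SeamInduction`;
items stmt-HubbardSuperconductivity-16311/16312/18509/18510). Everything here is KINEMATIC — true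
for every `U`, `θ`, `N`, every size and every labelling — and PROVED; no definitions, no named facts:

* `isHermitian_tubeTwist`, `isHermitian_tubeH`, `preservesSectors_tubeH` — the seam-twisted tube
  `tubeH0 + tubeTwist θ` is Hermitian and block diagonal in `(N↑, N↓)`;
* `tubeEnergy_neg` — TIME REVERSAL: `E_{L,M}(U; -θ, N) = E_{L,M}(U; θ, N)` (complex conjugation is
  entrywise, preserves `szSector N 0` and reverses the flux; Byers–Yang 1961);
* `tubeEnergy_relabel`, `tubeStiffness_relabel`, `tubePairCompressibility_relabel` — RELABELLING
  INVARIANCE: the twisted sector energies, hence `ρ̃_{L,M}` and `ẽ″_{L,M}`, are the same for any two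
  linearly ordered labellings `e : Λ ≃ ℤ/L × ℤ/M`, `e' : Λ' ≃ ℤ/L × ℤ/M` (signed-permutation
  transport `SiteBijectionSectorTransport`), so every "`∀ labellings`" clause of the four items is
  free;
* `exists_unit_isGroundStateInSector_tubeH0_tubeFilling` — normalised `(N_{L,M}(δ), S^z = 0)` sector
  ground states of the pure tube exist for every `δ ≥ -1` (the `∀ ψ` clause of `HaldaneLaw` is never
  vacuous); `card_carrier` — `|Λ| = LM`.

Companions: `WidthHaldaneTubeGauge` (the twist gauge spreads the seam flux uniformly) and
`WidthHaldaneTubeBlochBound` (Bloch's bound `E(θ) ≤ E(0) + θ²M/L`, hence `ρ̃_{L,M} ≤ 2`).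

References: N. Byers, C. N. Yang, PRL 7 (1961) 46; O. Bratteli, D. W. Robinson, *Operator Algebras
and Quantum Statistical Mechanics II* (1997) §5.2.2; E. H. Lieb, PRL 62 (1989) 1201.
-/

noncomputable section

namespace Summit.HubbardSuperconductivity.HubbardSuperconductivity.Theorems.WidthHaldane

set_option linter.dupNamespace false -- summit = problem name (single-conjunct summit), D-0017

open scoped BigOperators Classical Matrix ComplexConjugate
open Matrix Literature.MathematicalPhysics.QuantumLattice

section Basic

variable (L M : ℕ) [NeZero L] [NeZero M] (Λ : Type) [LinearOrder Λ] [Fintype Λ]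
  (e : Λ ≃ ZMod L × ZMod M)

/-! ### Hermiticity and sector preservation -/

omit [NeZero L] [NeZero M] in
/-- The adjoint of the `+`-oriented seam term is the `-`-oriented one:
`((1 - e^{iθ}) c†_{(0,b)σ} c_{(-1,b)σ})ᴴ = (1 - e^{-iθ}) c†_{(-1,b)σ} c_{(0,b)σ}`. [folklore] -/
theorem seamTerm_conjTranspose (θ : ℝ) (b : ZMod M) (σ : Fin 2) :
    ((1 - Complex.exp (Complex.I * θ)) •
        (creation (orb (e.symm (0, b)) σ) * annihilation (orb (e.symm (-1, b)) σ)) :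
          Matrix (Finset (Orb Λ)) (Finset (Orb Λ)) ℂ)ᴴ =
      (1 - Complex.exp (-(Complex.I * θ))) •
        (creation (orb (e.symm (-1, b)) σ) * annihilation (orb (e.symm (0, b)) σ)) := by
  rw [conjTranspose_smul, conjTranspose_mul, creation_conjTranspose, annihilation_conjTranspose]
  congr 1
  rw [Complex.star_def, map_sub, map_one, ← Complex.exp_conj, map_mul, Complex.conj_I,
    Complex.conj_ofReal, neg_mul]

/-- The seam twist is Hermitian (its two orientations are each other's adjoints). [folklore] -/
theorem isHermitian_tubeTwist (θ : ℝ) : (tubeTwist L M Λ e θ).IsHermitian := by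
  unfold Matrix.IsHermitian tubeTwist
  simp only [conjTranspose_sum, conjTranspose_add]
  refine Finset.sum_congr rfl fun b _ => Finset.sum_congr rfl fun σ _ => ?_
  have h1 := seamTerm_conjTranspose L M Λ e θ b σ
  have h2 := congrArg conjTranspose h1
  rw [conjTranspose_conjTranspose] at h2
  rw [h1, ← h2, add_comm]

omit [NeZero L] [NeZero M] in
/-- The pure tube `tubeH0` is Hermitian. [folklore] -/
theorem isHermitian_tubeH0 (U : ℝ) : (tubeH0 L M Λ e U).IsHermitian :=
  LiebThm1.hamiltonian_isHermitian (tubeGraph e) 1 U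

/-- The twisted tube `tubeH0 + tubeTwist θ` is Hermitian. [folklore] -/
theorem isHermitian_tubeH (U θ : ℝ) : (tubeH0 L M Λ e U + tubeTwist L M Λ e θ).IsHermitian :=
  (isHermitian_tubeH0 L M Λ e U).add (isHermitian_tubeTwist L M Λ e θ)

/-- The seam twist conserves `N↑` and `N↓` (spin-diagonal hoppings). [folklore] -/
theorem preservesSectors_tubeTwist (θ : ℝ) : PreservesSectors (tubeTwist L M Λ e θ) :=
  PreservesSectors.sum fun _ _ => PreservesSectors.sum fun σ _ =>
    ((LiebThm1.preservesSectors_hopping _ _ σ).smul _).add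
      ((LiebThm1.preservesSectors_hopping _ _ σ).smul _)

/-- The twisted tube conserves `N↑` and `N↓`. [folklore] -/
theorem preservesSectors_tubeH (U θ : ℝ) :
    PreservesSectors (tubeH0 L M Λ e U + tubeTwist L M Λ e θ) :=
  (LiebThm1.preservesSectors_hamiltonian (tubeGraph e) 1 U).add (preservesSectors_tubeTwist L M Λ e θ)

/-! ### Zero twist -/

/-- At zero flux the seam twist vanishes. [folklore] -/
@[simp] theorem tubeTwist_zero : tubeTwist L M Λ e 0 = 0 := by
  simp [tubeTwist]

/-- At zero flux the twisted sector energy is that of the pure tube. [folklore] -/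
theorem tubeEnergy_zero (U : ℝ) (N : ℕ) :
    tubeEnergy L M Λ e U 0 N = (tubeH0 L M Λ e U).minEnergyOn (szSector N 0) := by
  rw [tubeEnergy_eq, tubeTwist_zero, add_zero]

/-! ### Time reversal: `E(-θ) = E(θ)` -/

/-- Complex conjugation reverses the flux of the seam twist: `conj (tubeTwist θ) = tubeTwist (-θ)`
entrywise (the Jordan–Wigner matrices are real). [folklore] -/
theorem tubeTwist_map_conj (θ : ℝ) :
    (tubeTwist L M Λ e θ).map (starRingEnd ℂ) = tubeTwist L M Λ e (-θ) := by
  unfold tubeTwist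
  simp only [map_conj_sum, Matrix.map_add _ (map_add (starRingEnd ℂ)), map_conj_smul, Matrix.map_mul,
    creation_map_conj, annihilation_map_conj]
  refine Finset.sum_congr rfl fun b _ => Finset.sum_congr rfl fun σ _ => ?_
  have h1 : (starRingEnd ℂ) (1 - Complex.exp (Complex.I * θ)) =
      1 - Complex.exp (Complex.I * ((-θ : ℝ) : ℂ)) := by
    rw [map_sub, map_one, ← Complex.exp_conj, map_mul, Complex.conj_I, Complex.conj_ofReal,
      Complex.ofReal_neg, neg_mul, mul_neg]
  have h2 : (starRingEnd ℂ) (1 - Complex.exp (-(Complex.I * θ))) =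
      1 - Complex.exp (-(Complex.I * ((-θ : ℝ) : ℂ))) := by
    rw [map_sub, map_one, ← Complex.exp_conj, map_neg, map_mul, Complex.conj_I, Complex.conj_ofReal,
      Complex.ofReal_neg, neg_mul, mul_neg]
  rw [h1, h2]

/-- `conj (tubeH0 + tubeTwist θ) = tubeH0 + tubeTwist (-θ)` entrywise (`tubeH0` is real). [folklore] -/
theorem tubeH_map_conj (U θ : ℝ) :
    (tubeH0 L M Λ e U + tubeTwist L M Λ e θ).map (starRingEnd ℂ) =
      tubeH0 L M Λ e U + tubeTwist L M Λ e (-θ) := by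
  rw [Matrix.map_add _ (map_add (starRingEnd ℂ)), tubeTwist_map_conj, tubeH0_eq, hamiltonian_map_conj]

/-- **The twisted sector energies are even in the flux**: `E_{L,M}(U; -θ, N) = E_{L,M}(U; θ, N)`
(time reversal = complex conjugation preserves the sector `(N, S^z = 0)` and reverses the flux;
Byers–Yang 1961). [cite: ByersYang1961, p. 46] -/
theorem tubeEnergy_neg (U θ : ℝ) (N : ℕ) :
    tubeEnergy L M Λ e U (-θ) N = tubeEnergy L M Λ e U θ N := by
  rw [tubeEnergy_eq, tubeEnergy_eq, ← tubeH_map_conj]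
  exact minEnergyOn_map_conj _ _ fun ψ h => star_mem_szSector h

end Basic

/-! ### Relabelling invariance: the labelling `e : Λ ≃ ℤ/L × ℤ/M` is immaterial -/

section Relabel

variable (L M : ℕ) [NeZero L] [NeZero M] (Λ : Type) [LinearOrder Λ] [Fintype Λ]
  (e : Λ ≃ ZMod L × ZMod M) (Λ' : Type) [LinearOrder Λ'] [Fintype Λ'] (e' : Λ' ≃ ZMod L × ZMod M)

omit [NeZero L] [NeZero M] [LinearOrder Λ] [Fintype Λ] [LinearOrder Λ'] [Fintype Λ'] in
/-- The site bijection `e'⁻¹ ∘ e : Λ ≃ Λ'` intertwines the two labellings. [folklore] -/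
theorem apply_trans_symm_apply (x : Λ) : e' ((e.trans e'.symm) x) = e x := by
  simp

omit [NeZero L] [NeZero M] [LinearOrder Λ] [Fintype Λ] [LinearOrder Λ'] [Fintype Λ'] in
/-- The site bijection `e'⁻¹ ∘ e` is a graph isomorphism of the two labelled tubes. [folklore] -/
theorem tubeGraph_adj_trans_symm (x y : Λ) :
    (tubeGraph e').Adj ((e.trans e'.symm) x) ((e.trans e'.symm) y) ↔ (tubeGraph e).Adj x y := by
  have key : ∀ (z : Λ) (q : ZMod L × ZMod M), (e.trans e'.symm) z = e'.symm q ↔ z = e.symm q := by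
    intro z q
    rw [Equiv.trans_apply, e'.symm.apply_eq_iff_eq, Equiv.eq_symm_apply]
  simp only [tubeGraph, SimpleGraph.fromRel_adj, ne_eq, EmbeddingLike.apply_eq_iff_eq,
    apply_trans_symm_apply, key]

omit [NeZero L] [NeZero M] in
/-- **The pure tube is covariant under relabelling**: `Γ_f H₀(e) Γ_f⁻¹ = H₀(e')`, `f = e'⁻¹ ∘ e`.
[folklore] -/
theorem relabel_tubeH0 (U : ℝ) :
    relabel (Orb.mapEquiv (e.trans e'.symm)) (tubeH0 L M Λ e U) = tubeH0 L M Λ' e' U := by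
  rw [tubeH0_eq, tubeH0_eq]
  exact relabel_hamiltonian (tubeGraph e) (tubeGraph e') (e.trans e'.symm)
    (tubeGraph_adj_trans_symm L M Λ e Λ' e') 1 U

/-- **The seam twist is covariant under relabelling**: `Γ_f Tw_θ(e) Γ_f⁻¹ = Tw_θ(e')`. [folklore] -/
theorem relabel_tubeTwist (θ : ℝ) :
    relabel (Orb.mapEquiv (e.trans e'.symm)) (tubeTwist L M Λ e θ) = tubeTwist L M Λ' e' θ := by
  unfold tubeTwist
  simp only [map_sum, map_add, map_smul, map_mul, relabel_creation, relabel_annihilation,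
    Orb.mapEquiv_orb, Equiv.trans_apply, Equiv.apply_symm_apply]

/-- **The twisted sector energies do not depend on the labelling**:
`E_{L,M}(U; θ, N)` is the same for any two linearly ordered labellings `e : Λ ≃ ℤ/L × ℤ/M`,
`e' : Λ' ≃ ℤ/L × ℤ/M` (the signed-permutation relabelling `Γ_{e'⁻¹e}` is unitary, maps the sector
`(N, S^z = 0)` onto itself and conjugates `H₀ + Tw_θ` on `Λ` into `H₀ + Tw_θ` on `Λ'`).
[cite: BratteliRobinsonII1997, §5.2.2, Thm. 5.2.5] -/
theorem tubeEnergy_relabel (U θ : ℝ) (N : ℕ) :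
    tubeEnergy L M Λ e U θ N = tubeEnergy L M Λ' e' U θ N := by
  rw [tubeEnergy_eq, tubeEnergy_eq, ← relabel_tubeH0 L M Λ e Λ' e' U,
    ← relabel_tubeTwist L M Λ e Λ' e' θ, ← map_add, minEnergyOn_relabel_szSector]

/-- The twist stiffness per site does not depend on the labelling. [folklore] -/
theorem tubeStiffness_relabel (U δ : ℝ) :
    tubeStiffness L M Λ e U δ = tubeStiffness L M Λ' e' U δ := by
  rw [tubeStiffness_eq, tubeStiffness_eq, tubeEnergy_relabel L M Λ e Λ' e',
    tubeEnergy_relabel L M Λ e Λ' e']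

/-- The inverse pair compressibility does not depend on the labelling. [folklore] -/
theorem tubePairCompressibility_relabel (U δ : ℝ) :
    tubePairCompressibility L M Λ e U δ = tubePairCompressibility L M Λ' e' U δ := by
  rw [tubePairCompressibility_eq, tubePairCompressibility_eq, tubeEnergy_relabel L M Λ e Λ' e',
    tubeEnergy_relabel L M Λ e Λ' e' U 0 (tubeFilling L M δ - 2),
    tubeEnergy_relabel L M Λ e Λ' e' U 0 (tubeFilling L M δ)]

end Relabel

section Card

variable (L M : ℕ) [NeZero L] [NeZero M] (Λ : Type) [LinearOrder Λ] [Fintype Λ]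
  (e : Λ ≃ ZMod L × ZMod M)

include e in
omit [LinearOrder Λ] in
/-- The number of sites of the labelled tube: `|Λ| = L M`. [folklore] -/
theorem card_carrier : Fintype.card Λ = L * M := by
  rw [Fintype.card_congr e, Fintype.card_prod, ZMod.card, ZMod.card]

end Card

section GroundStates

variable (L M : ℕ) [NeZero L] [NeZero M] (Λ : Type) [LinearOrder Λ] [Fintype Λ]
  (e : Λ ≃ ZMod L × ZMod M)

omit [NeZero L] [NeZero M] in
/-- A nonzero scalar multiple of a sector ground state is a sector ground state. [folklore] -/
theorem isGroundStateInSector_smul {H : Matrix (Finset (Orb Λ)) (Finset (Orb Λ)) ℂ} {N : ℕ} {Sz : ℝ}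
    {φ : Fock (Orb Λ)} (h : IsGroundStateInSector H N Sz φ) {c : ℂ} (hc : c ≠ 0) :
    IsGroundStateInSector H N Sz (c • φ) :=
  ⟨Submodule.smul_mem _ c h.1, smul_ne_zero hc h.2.1, by rw [mulVec_smul, h.2.2, smul_comm]⟩

/-- **Normalised sector ground states of the pure tube exist** in every sector `(2n, S^z = 0)` with
`n ≤ LM` (the tube Hamiltonian is Hermitian and block diagonal in `(N↑, N↓)`; Lieb, PRL 62 (1989)
1201, proof of Thm 1). In particular the `∀ ψ` clause of `HaldaneLaw` is never vacuous.
[cite: LiebPRL1989, proof of Theorem 1] -/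
theorem exists_unit_isGroundStateInSector_tubeH0 (U : ℝ) {n : ℕ} (hn : n ≤ L * M) :
    ∃ ψ : Fock (Orb Λ), star ψ ⬝ᵥ ψ = 1 ∧ IsGroundStateInSector (tubeH0 L M Λ e U) (2 * n) 0 ψ := by
  have hcard : n ≤ Fintype.card Λ := by rwa [card_carrier L M Λ e]
  obtain ⟨⟨φ, hφ⟩, -⟩ := szSector_groundState (tubeGraph e) 1 U hcard
  obtain ⟨c, hc0, hc1⟩ := exists_smul_unit hφ.2.1
  exact ⟨c • φ, hc1, isGroundStateInSector_smul Λ hφ hc0⟩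

omit [NeZero L] [NeZero M] in
/-- The filling fits on the tube: `⌊(1-δ)LM/2⌋ ≤ LM` for `δ ≥ -1`. [folklore] -/
theorem half_tubeFilling_le {δ : ℝ} (hδ : -1 ≤ δ) : ⌊(1 - δ) * ((L : ℝ) * (M : ℝ)) / 2⌋₊ ≤ L * M := by
  refine Nat.floor_le_of_le ?_
  have hLM : (0 : ℝ) ≤ (L : ℝ) * M := by positivity
  have h1 : (1 - δ) * ((L : ℝ) * M) ≤ 2 * ((L : ℝ) * M) := mul_le_mul_of_nonneg_right (by linarith) hLM
  push_cast
  linarith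

/-- **Normalised ground states exist at the cruxes' filling** `N_{L,M}(δ) = 2⌊(1-δ)LM/2⌋` for every
`δ ≥ -1` (so for every doping in `(0, 3/10)`), every `U` and every labelled tube.
[cite: LiebPRL1989, proof of Theorem 1] -/
theorem exists_unit_isGroundStateInSector_tubeH0_tubeFilling (U : ℝ) {δ : ℝ} (hδ : -1 ≤ δ) :
    ∃ ψ : Fock (Orb Λ), star ψ ⬝ᵥ ψ = 1 ∧
      IsGroundStateInSector (tubeH0 L M Λ e U) (tubeFilling L M δ) 0 ψ :=
  exists_unit_isGroundStateInSector_tubeH0 L M Λ e U (half_tubeFilling_le L M hδ)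

end GroundStates

end Summit.HubbardSuperconductivity.HubbardSuperconductivity.Theorems.WidthHaldane

end
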